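import Mathlib
import HarnessLib
import Literature.Analysis.FluidPDE.VectorCalculus
import Literature.Analysis.FluidPDE.VorticityCalculus
import Literature.Analysis.FluidPDE.Vorticity
import Literature.Analysis.FluidPDE.VorticityEquation
import Literature.Analysis.FluidPDE.ClassicalSolution
import Literature.Analysis.FluidPDE.SpaceTimeCalculus
import Literature.Analysis.FluidPDE.TypeIAncientMild
import Literature.Analysis.FluidPDE.TypeIAncientMildClassical
import Summits.NavierStokesRegularity.NavierStokesRegularity.Theorems.PoloidalWindowDoorPoloidalWindowRigidityWindow
import Summits.NavierStokesRegularity.NavierStokesRegularity.Theorems.PoloidalWindowDoorPoloidalWindowRigidityFirstIntegral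
import Summits.NavierStokesRegularity.NavierStokesRegularity.Theorems.PoloidalWindowDoorPoloidalWindowRigidityHorizontalSourceGauge
import Summits.NavierStokesRegularity.NavierStokesRegularity.Theorems.PoloidalWindowDoorPoloidalWindowRigidityVelocityGradientLaw

/-!
# Route `PoloidalWindowDoor`, crux `PoloidalWindowRigidity` (K2, stmt-NavierStokesRegularity-19708) —
# the SEPARATED-PRESSURE stratum: two parallel solutions of one linear law

Cell ns-regularity-ideate, seat ns-poloidal-K2-p3 (stub-worker, gen 2; support theorems `--supports` the crux,
`--as helper`).  Kernel form of the structural heart of the K2 lead's H4c programme (K2P1-S2-NOTES v4 §4, there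
derived by hand and kit-certified, j259272).  Notation: indices `0,1` horizontal, `2` vertical; `v` a profile of
the route's Type-I class, `ω = curl v`, `f := ∂ₜv + (v·∇)v − Δv` the intrinsic residual (`= −∇p` on windows),
`L := ∂ₜ + (v·∇) − Δ` acting on scalars, `∂ⱼvᵢ = (Dv eⱼ)ᵢ`.

* `horizontalVorticity_equation` — the class, poloidal along `e₃` (`ω₂ ≡ 0`): for `a = 0,1`,
  `L(ωₐ) = ω₀·∂₀vₐ + ω₁·∂₁vₐ` (the horizontal vorticity is transported–stretched by the horizontal strain only).
* `verticalGradient_equation` — the class: `L(∂ₐv₂) = (∂ₐf)₂ − (Dv(∂ₐv))₂` for every direction `a` (the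
  `e₃`-row of the velocity-gradient law `…VelocityGradientLaw.fderiv_equation_coord`).
* THE SEPARATED-PRESSURE STRATUM `∇_h f₂ ≡ 0` (`∂₀∂₂p ≡ ∂₁∂₂p ≡ 0`, i.e. `p = q(x_h,t) + P(x₂,t)`; it contains the
  settled strata (V) `∂₂p = c(t)` (this seat, p462355) and «`∇_h p = c_h(t)`» (p472147), and the NS members of
  K2-p1's constant-Clebsch-slope stratum, see below): `rotatedGradient_equation_of_separatedPressure` — for the
  ROTATED horizontal gradient `Y := J∇_h v₂ = (−∂₁v₂, ∂₀v₂)` and `a = 0,1`, **`L(Yₐ) = Y₀·∂₀vₐ + Y₁·∂₁vₐ`** — the SAME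
  linear law as `ω_h` (uses `ω₂ ≡ 0`: `∂₀v₁ = ∂₁v₀`, and `div v = 0`); and `rotatedGradient_wedge_vorticity_eq_zero`:
  `Y ∥ ω_h` pointwise (`Y₀ω₁ − Y₁ω₀ = 0`, the frozen constraint).  So on this stratum `ω_h` and `J∇_h v₂` are two
  POINTWISE PARALLEL solutions of one linear parabolic 2-system; their ratio is the Clebsch slope `−Λ`
  (`∇_h v₂ = Λ∇_hψ`, `∇_hψ = Jω_h`), whence K2-p1's source-free law `|ω|²(∂ₜ + v·∇)Λ = div(|ω|²∇Λ)` on `{ω ≠ 0}`.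
* `separatedPressure_of_clebschSlope` — K2P1-S2-NOTES §3bis(a) in the kernel: a profile of the class, poloidal,
  with CONSTANT CLEBSCH SLOPE in the form `∂₂v_b ≡ μ·∂_b v₂` (`b = 0,1`, one `μ ≠ 1`; `μ = 1 − 1/λ`) lies in the
  separated-pressure stratum: `∇_h f₂ ≡ 0` and `∂₂ f_h ≡ 0` (apply `L` to the linear constraint, use the two laws
  above and `curl f = 0`).

WHAT THIS IS NOT: not a claim about Navier–Stokes regularity and not the open residue S2′ — structure theorems for
one located stratum of a door route's Type-I Liouville problem (bears_on LADDER-NS N0, rung N0-LocalTubeDoorPoloidal).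
-/

noncomputable section

-- the summit and its single sub-problem share the name (CONVENTIONS §1), as in every Theorems file
set_option linter.dupNamespace false

namespace Summit.NavierStokesRegularity.NavierStokesRegularity.Theorems.PoloidalWindowDoorPoloidalWindowRigiditySeparatedPressure

open MeasureTheory Set Function Filter Topology TopologicalSpace Metric InnerProductSpace
open scoped RealInnerProductSpace InnerProductSpace Laplacian ContDiff
open Literature.Analysis Literature.Analysis.FluidPDE
open Summit.NavierStokesRegularity.NavierStokesRegularity.Theorems.PoloidalWindowDoorPoloidalWindowRigidityWindow
open Summit.NavierStokesRegularity.NavierStokesRegularity.Theorems.PoloidalWindowDoorPoloidalWindowRigidityFirstIntegral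
open Summit.NavierStokesRegularity.NavierStokesRegularity.Theorems.PoloidalWindowDoorPoloidalWindowRigidityHorizontalSourceGauge
open Summit.NavierStokesRegularity.NavierStokesRegularity.Theorems.PoloidalWindowDoorPoloidalWindowRigidityVelocityGradientLaw

variable {C : ℝ} {v : ℝ → EuclideanSpace ℝ (Fin 3) → EuclideanSpace ℝ (Fin 3)}

/-! ### Linear algebra on `ℝ³` -/

/-- Expansion of a vector of `ℝ³` in the standard basis. -/
theorem eq_sum_single (w : EuclideanSpace ℝ (Fin 3)) :
    w = ∑ j : Fin 3, w j • (EuclideanSpace.single j (1 : ℝ) : EuclideanSpace ℝ (Fin 3)) := by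
  ext i
  fin_cases i <;> simp [Fin.sum_univ_three]

/-- `(D(D a))ᵢ = ∑ⱼ (D a)ⱼ (D eⱼ)ᵢ` for a linear map `D` on `ℝ³`. -/
theorem apply_apply_coord (D : EuclideanSpace ℝ (Fin 3) →L[ℝ] EuclideanSpace ℝ (Fin 3))
    (a : EuclideanSpace ℝ (Fin 3)) (i : Fin 3) :
    D (D a) i = ∑ j : Fin 3, D a j * D (EuclideanSpace.single j 1) i := by
  conv_lhs => rw [eq_sum_single (D a)]
  simp [map_smul, Fin.sum_univ_three]

/-! ### The horizontal vorticity law of a poloidal profile -/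

/-- **Vorticity equation of the class, Cartesian components, scalar shape.**  For a profile of the route's Type-I
class, `t < 0`, `x`, `i`: `∂ₜωᵢ + Dωᵢ(v) − Δωᵢ = (Dv ω)ᵢ` at `(t,x)` (`ω = curl v`; Literature vorticity
formulation of the classical window `(2t,0)`). -/
theorem curl_equation_coord (hrate : HasTypeITimeDecay C v)
    (hcont : ContinuousOn (uncurry v) (Iio (0 : ℝ) ×ˢ univ))
    (hmild : ∀ s t : ℝ, s < t → t < 0 → ∀ x,
      v t x = UnboundedOperators.heatExtension (v s) (t - s) x - oseenDuhamel 1 s v v t x)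
    (hdiv : ∀ t < 0, VectorCalculus.IsDivFree (v t)) {t : ℝ} (ht : t < 0) (x : EuclideanSpace ℝ (Fin 3))
    (i : Fin 3) :
    deriv (fun s => curl (v s) x i) t + fderiv ℝ (fun y => curl (v t) y i) x (v t x)
        - Δ (fun y => curl (v t) y i) x = fderiv ℝ (v t) x (curl (v t) x) i := by
  have hA : IsTypeIAncientMild C v := isTypeIAncientMild_of_class hrate hcont hmild hdiv
  have h2t : 2 * t < 0 := by linarith
  have htS : t ∈ Ioo (2 * t) 0 := ⟨by linarith, ht⟩
  obtain ⟨p, hns⟩ := hA.exists_isClassicalNSSolutionOn_Ioo h2t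
  have hV : IsVorticitySolutionOn (Ioo (2 * t) 0) 1 v :=
    hns.isVorticitySolutionOn_zero_force isOpen_Ioo.uniqueDiffOn
      (by rw [isOpen_Ioo.interior_eq]; exact subset_closure)
  have hω : IsSmoothSpaceTimeOn (Ioo (2 * t) 0) (vorticity v) :=
    hV.smooth_velocity.isSmoothSpaceTimeOn_vorticity isOpen_Ioo.uniqueDiffOn
  have hv3 : ContDiff ℝ 3 (v t) := (hA.contDiff_slice ht).of_le (by norm_cast)
  have hc2 : ContDiff ℝ 2 (curl (v t)) := contDiff_curl (n := 2) (by exact_mod_cast hv3)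
  set P : EuclideanSpace ℝ (Fin 3) →L[ℝ] ℝ := EuclideanSpace.proj (𝕜 := ℝ) i with hP
  have heq := hV.vorticity_eq t htS x
  -- (T) the time derivative, coordinate `i`
  have hT : deriv (fun s => curl (v s) x i) t = (timeDerivWithin (Ioo (2 * t) 0) (vorticity v) t x) i := by
    rw [timeDerivWithin_eq_deriv_of_isOpen_subset isOpen_Ioo subset_rfl htS (vorticity v)]
    have hd : DifferentiableAt ℝ (fun s => vorticity v s x) t :=
      (hω.differentiableWithinAt_time htS x).differentiableAt (isOpen_Ioo.mem_nhds htS)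
    have h := (P.hasFDerivAt.comp_hasDerivAt t hd.hasDerivAt).deriv
    simpa [hP, Function.comp_def] using h
  -- (X) the convective term, coordinate `i`
  have hX : fderiv ℝ (fun y => curl (v t) y i) x (v t x) = (convect (v t) (vorticity v t) x) i := by
    have hd : DifferentiableAt ℝ (curl (v t)) x := (hc2.differentiable (by norm_num)) x
    simp only [convect, vorticity_apply]
    rw [PoloidalWindowDoorPoloidalWindowRigidityFlat.fderiv_apply_coord hd]
  -- (L) the Laplacian, coordinate `i`
  have hL : Δ (fun y => curl (v t) y i) x = (Δ (vorticity v t) x) i := by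
    have hfun : (fun y => curl (v t) y i) = P ∘ curl (v t) := by funext y; simp [hP]
    rw [hfun, hc2.contDiffAt.laplacian_CLM_comp_left]
    simp [hP]
  rw [hT, hX, hL]
  have h := congrArg (fun z : EuclideanSpace ℝ (Fin 3) => z i) heq
  simp only [one_smul, PiLp.add_apply] at h
  simp only [convect, vorticity_apply] at h ⊢
  linarith

/-- **Horizontal vorticity law of a POLOIDAL profile.**  If `ω₂ ≡ 0` on the slice `t`, then for `a = 0, 1`:
`∂ₜωₐ + Dωₐ(v) − Δωₐ = ω₀·∂₀vₐ + ω₁·∂₁vₐ` at `(t,x)` — only the horizontal strain stretches `ω_h`. -/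
theorem horizontalVorticity_equation (hrate : HasTypeITimeDecay C v)
    (hcont : ContinuousOn (uncurry v) (Iio (0 : ℝ) ×ˢ univ))
    (hmild : ∀ s t : ℝ, s < t → t < 0 → ∀ x,
      v t x = UnboundedOperators.heatExtension (v s) (t - s) x - oseenDuhamel 1 s v v t x)
    (hdiv : ∀ t < 0, VectorCalculus.IsDivFree (v t)) {t : ℝ} (ht : t < 0)
    (hpol : ∀ y, ⟪curl (v t) y, EuclideanSpace.single 2 1⟫_ℝ = 0) (x : EuclideanSpace ℝ (Fin 3)) (a : Fin 3) :
    deriv (fun s => curl (v s) x a) t + fderiv ℝ (fun y => curl (v t) y a) x (v t x)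
        - Δ (fun y => curl (v t) y a) x =
      curl (v t) x 0 * fderiv ℝ (v t) x (EuclideanSpace.single 0 1) a +
        curl (v t) x 1 * fderiv ℝ (v t) x (EuclideanSpace.single 1 1) a := by
  rw [curl_equation_coord hrate hcont hmild hdiv ht x a]
  have hω2 : curl (v t) x 2 = 0 := by simpa [EuclideanSpace.inner_single_right] using hpol x
  conv_lhs => rw [eq_sum_single (curl (v t) x)]
  simp [map_smul, Fin.sum_univ_three, hω2]

/-! ### The vertical-gradient law and the separated-pressure stratum -/

/-- **Vertical-gradient law.**  For the class, `t < 0`, `x` and any direction `a`, `θ = ∂ₐv₂ = (Dv a)₂` obeys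
`∂ₜθ + Dθ(v) − Δθ = (∂ₐf)₂ − (Dv(∂ₐv))₂` (the `e₃`-row of `…VelocityGradientLaw.fderiv_equation_coord`). -/
theorem verticalGradient_equation (hrate : HasTypeITimeDecay C v)
    (hcont : ContinuousOn (uncurry v) (Iio (0 : ℝ) ×ˢ univ))
    (hmild : ∀ s t : ℝ, s < t → t < 0 → ∀ x,
      v t x = UnboundedOperators.heatExtension (v s) (t - s) x - oseenDuhamel 1 s v v t x)
    (hdiv : ∀ t < 0, VectorCalculus.IsDivFree (v t)) {t : ℝ} (ht : t < 0) (x a : EuclideanSpace ℝ (Fin 3)) :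
    deriv (fun s => fderiv ℝ (v s) x a 2) t + fderiv ℝ (fun y => fderiv ℝ (v t) y a 2) x (v t x)
        - Δ (fun y => fderiv ℝ (v t) y a 2) x =
      fderiv ℝ (fun y => timeDerivWithin (Iio 0) v t y + convect (v t) (v t) y - Δ (v t) y) x a 2
        - ∑ j : Fin 3, fderiv ℝ (v t) x a j * fderiv ℝ (v t) x (EuclideanSpace.single j 1) 2 := by
  rw [fderiv_equation_coord hrate hcont hmild hdiv ht x a 2, apply_apply_coord]

/-- **THE CLOSED LAW ON THE SEPARATED-PRESSURE STRATUM (intrinsic form).**  If the vertical component of the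
residual has no horizontal gradient on the slice `t` (`(∂ₐf)₂ = 0` for `a ⟂ e₃`; i.e. `∂₂p(t,·)` depends on `x₂`
only), then for every horizontal `a`: `L(∂ₐv₂) = −(Dv(∂ₐv))₂` — a linear law in `∇v` with NO pressure term. -/
theorem verticalGradient_equation_of_separatedPressure (hrate : HasTypeITimeDecay C v)
    (hcont : ContinuousOn (uncurry v) (Iio (0 : ℝ) ×ˢ univ))
    (hmild : ∀ s t : ℝ, s < t → t < 0 → ∀ x,
      v t x = UnboundedOperators.heatExtension (v s) (t - s) x - oseenDuhamel 1 s v v t x)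
    (hdiv : ∀ t < 0, VectorCalculus.IsDivFree (v t)) {t : ℝ} (ht : t < 0)
    (hsep : ∀ (x a : EuclideanSpace ℝ (Fin 3)), ⟪a, EuclideanSpace.single 2 1⟫_ℝ = 0 →
      fderiv ℝ (fun y => timeDerivWithin (Iio 0) v t y + convect (v t) (v t) y - Δ (v t) y) x a 2 = 0)
    (x : EuclideanSpace ℝ (Fin 3)) {a : EuclideanSpace ℝ (Fin 3)} (ha : ⟪a, EuclideanSpace.single 2 1⟫_ℝ = 0) :
    deriv (fun s => fderiv ℝ (v s) x a 2) t + fderiv ℝ (fun y => fderiv ℝ (v t) y a 2) x (v t x)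
        - Δ (fun y => fderiv ℝ (v t) y a 2) x =
      - ∑ j : Fin 3, fderiv ℝ (v t) x a j * fderiv ℝ (v t) x (EuclideanSpace.single j 1) 2 := by
  rw [verticalGradient_equation hrate hcont hmild hdiv ht x a, hsep x a ha, zero_sub]

/-- **SAME LAW AS THE VORTICITY: the rotated horizontal gradient `Y = J∇_h v₂ = (−∂₁v₂, ∂₀v₂)` on the
separated-pressure stratum.**  For a profile of the class, poloidal on the slice `t` (`ω₂ ≡ 0`, so
`∂₀v₁ = ∂₁v₀`), with `(∂ₐf)₂ = 0` for horizontal `a` on that slice: writing `Y₀ = −∂₁v₂`, `Y₁ = ∂₀v₂`,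
for `a = 0, 1`:  `L(Yₐ) = Y₀·∂₀vₐ + Y₁·∂₁vₐ` — literally the law of `horizontalVorticity_equation` (the extra
input is `div v = 0`: `∂₂v₂ = −∂₀v₀ − ∂₁v₁`).  Stated as the pair of identities for `L(∂₀v₂)` and `L(∂₁v₂)`. -/
theorem rotatedGradient_equation_of_separatedPressure (hrate : HasTypeITimeDecay C v)
    (hcont : ContinuousOn (uncurry v) (Iio (0 : ℝ) ×ˢ univ))
    (hmild : ∀ s t : ℝ, s < t → t < 0 → ∀ x,
      v t x = UnboundedOperators.heatExtension (v s) (t - s) x - oseenDuhamel 1 s v v t x)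
    (hdiv : ∀ t < 0, VectorCalculus.IsDivFree (v t)) {t : ℝ} (ht : t < 0)
    (hpol : ∀ y, ⟪curl (v t) y, EuclideanSpace.single 2 1⟫_ℝ = 0)
    (hsep : ∀ (x a : EuclideanSpace ℝ (Fin 3)), ⟪a, EuclideanSpace.single 2 1⟫_ℝ = 0 →
      fderiv ℝ (fun y => timeDerivWithin (Iio 0) v t y + convect (v t) (v t) y - Δ (v t) y) x a 2 = 0)
    (x : EuclideanSpace ℝ (Fin 3)) :
    -- `L(Y₁) = L(∂₀v₂) = Y₀ ∂₀v₁ + Y₁ ∂₁v₁ = −∂₁v₂·∂₀v₁ + ∂₀v₂·∂₁v₁`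
    (deriv (fun s => fderiv ℝ (v s) x (EuclideanSpace.single 0 1) 2) t
        + fderiv ℝ (fun y => fderiv ℝ (v t) y (EuclideanSpace.single 0 1) 2) x (v t x)
        - Δ (fun y => fderiv ℝ (v t) y (EuclideanSpace.single 0 1) 2) x =
      -fderiv ℝ (v t) x (EuclideanSpace.single 1 1) 2 * fderiv ℝ (v t) x (EuclideanSpace.single 0 1) 1 +
        fderiv ℝ (v t) x (EuclideanSpace.single 0 1) 2 * fderiv ℝ (v t) x (EuclideanSpace.single 1 1) 1) ∧
    -- `L(Y₀) = −L(∂₁v₂) = Y₀ ∂₀v₀ + Y₁ ∂₁v₀`, i.e. `L(∂₁v₂) = ∂₁v₂·∂₀v₀ − ∂₀v₂·∂₁v₀`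
    (deriv (fun s => fderiv ℝ (v s) x (EuclideanSpace.single 1 1) 2) t
        + fderiv ℝ (fun y => fderiv ℝ (v t) y (EuclideanSpace.single 1 1) 2) x (v t x)
        - Δ (fun y => fderiv ℝ (v t) y (EuclideanSpace.single 1 1) 2) x =
      fderiv ℝ (v t) x (EuclideanSpace.single 1 1) 2 * fderiv ℝ (v t) x (EuclideanSpace.single 0 1) 0 -
        fderiv ℝ (v t) x (EuclideanSpace.single 0 1) 2 * fderiv ℝ (v t) x (EuclideanSpace.single 1 1) 0) := by
  have hA : IsTypeIAncientMild C v := isTypeIAncientMild_of_class hrate hcont hmild hdiv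
  have h0 : ⟪(EuclideanSpace.single 0 1 : EuclideanSpace ℝ (Fin 3)), EuclideanSpace.single 2 1⟫_ℝ = 0 := by
    simp [EuclideanSpace.inner_single_left]
  have h1 : ⟪(EuclideanSpace.single 1 1 : EuclideanSpace ℝ (Fin 3)), EuclideanSpace.single 2 1⟫_ℝ = 0 := by
    simp [EuclideanSpace.inner_single_left]
  -- poloidal: `∂₀v₁ = ∂₁v₀`
  have hω2 : curl (v t) x 2 = 0 := by simpa [EuclideanSpace.inner_single_right] using hpol x
  have hsym : fderiv ℝ (v t) x (EuclideanSpace.single 0 1) 1 = fderiv ℝ (v t) x (EuclideanSpace.single 1 1) 0 := by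
    have h : fderiv ℝ (v t) x (EuclideanSpace.single 0 1) 1 - fderiv ℝ (v t) x (EuclideanSpace.single 1 1) 0 = 0 := by
      simpa [curl] using hω2
    linarith
  -- div-free: `∂₀v₀ + ∂₁v₁ + ∂₂v₂ = 0`
  have hdv : fderiv ℝ (v t) x (EuclideanSpace.single 0 1) 0 + fderiv ℝ (v t) x (EuclideanSpace.single 1 1) 1 +
      fderiv ℝ (v t) x (EuclideanSpace.single 2 1) 2 = 0 := by
    have hd := hdiv t ht x
    rw [divergence_eq_sum_inner_fderiv (EuclideanSpace.basisFun (Fin 3) ℝ)] at hd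
    simpa only [Fin.sum_univ_three, EuclideanSpace.basisFun_apply, EuclideanSpace.inner_single_left,
      map_one, one_mul] using hd
  refine ⟨?_, ?_⟩
  · rw [verticalGradient_equation_of_separatedPressure hrate hcont hmild hdiv ht hsep x h0]
    simp only [Fin.sum_univ_three]
    have h22 : fderiv ℝ (v t) x (EuclideanSpace.single 2 1) 2 =
        -(fderiv ℝ (v t) x (EuclideanSpace.single 0 1) 0 + fderiv ℝ (v t) x (EuclideanSpace.single 1 1) 1) := by
      linarith
    rw [h22, hsym]
    ring
  · rw [verticalGradient_equation_of_separatedPressure hrate hcont hmild hdiv ht hsep x h1]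
    simp only [Fin.sum_univ_three]
    have h22 : fderiv ℝ (v t) x (EuclideanSpace.single 2 1) 2 =
        -(fderiv ℝ (v t) x (EuclideanSpace.single 0 1) 0 + fderiv ℝ (v t) x (EuclideanSpace.single 1 1) 1) := by
      linarith
    rw [h22, ← hsym]
    ring

/-- **`Y = J∇_h v₂` is pointwise PARALLEL to `ω_h`** (`Y₀ω₁ − Y₁ω₀ = −(ω₀∂₀v₂ + ω₁∂₁v₂) = 0`): the frozen
constraint `⟪Dv ω, e₃⟫ ≡ 0` of a poloidal profile of the class (nsreg-p6 `stub_firstIntegral`). -/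
theorem rotatedGradient_wedge_vorticity_eq_zero (hrate : HasTypeITimeDecay C v)
    (hcont : ContinuousOn (uncurry v) (Iio (0 : ℝ) ×ˢ univ))
    (hmild : ∀ s t : ℝ, s < t → t < 0 → ∀ x,
      v t x = UnboundedOperators.heatExtension (v s) (t - s) x - oseenDuhamel 1 s v v t x)
    (hdiv : ∀ t < 0, VectorCalculus.IsDivFree (v t))
    (hpol : ∀ s < 0, ∀ y, ⟪curl (v s) y, EuclideanSpace.single 2 1⟫_ℝ = 0) {t : ℝ} (ht : t < 0)
    (x : EuclideanSpace ℝ (Fin 3)) :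
    (-fderiv ℝ (v t) x (EuclideanSpace.single 1 1) 2) * curl (v t) x 1 -
        fderiv ℝ (v t) x (EuclideanSpace.single 0 1) 2 * curl (v t) x 0 = 0 := by
  have hfro := stub_firstIntegral C v hrate hcont hmild hdiv (EuclideanSpace.single 2 1) hpol t ht x
  have hω2 : curl (v t) x 2 = 0 := by simpa [EuclideanSpace.inner_single_right] using hpol t ht x
  -- `⟪Dv ω, e₃⟫ = ∑ⱼ ωⱼ ∂ⱼv₂ = ω₀ ∂₀v₂ + ω₁ ∂₁v₂`
  have hexp : ⟪fderiv ℝ (v t) x (curl (v t) x), EuclideanSpace.single 2 1⟫_ℝ =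
      curl (v t) x 0 * fderiv ℝ (v t) x (EuclideanSpace.single 0 1) 2 +
        curl (v t) x 1 * fderiv ℝ (v t) x (EuclideanSpace.single 1 1) 2 := by
    rw [EuclideanSpace.inner_single_right]
    conv_lhs => rw [eq_sum_single (curl (v t) x)]
    simp [map_smul, Fin.sum_univ_three, hω2]
  rw [hexp] at hfro
  linear_combination (-1 : ℝ) * hfro

/-! ### Constant Clebsch slope ⇒ separated pressure -/

/-- **CONSTANT CLEBSCH SLOPE ⇒ SEPARATED PRESSURE** (K2P1-S2-NOTES §3bis(a), kernel).  Let `v` be a profile of the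
route's Type-I class, poloidal along `e₃`, whose horizontal velocity has PROPORTIONAL VERTICAL SHEAR
`∂₂v_b ≡ μ ∂_b v₂` (`b = 0,1`) on the whole slab for one constant `μ ≠ 1` (constant Clebsch slope `λ = 1/(1−μ)`;
`μ = 0` is the vertically rigid stratum).  Then the pressure separates: for every `t < 0`, `x` and `b = 0,1`,
`(∂_b f)₂ = 0` and `(∂₂ f)_b = 0` (`∇_h∂₂p ≡ 0 ≡ ∂₂∇_h p`).  Proof: apply `L` to the linear constraint —
`L(∂₂v_b) = μ L(∂_b v₂)` — insert the velocity-gradient law on both sides; the quadratic terms `(Dv(∂₂v))_b` and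
`μ(Dv(∂_b v))₂` agree by the constraint and `∂₀v₁ = ∂₁v₀`, leaving `(∂₂f)_b = μ(∂_b f)₂`; and `curl f = 0` gives
`(∂₂f)_b = (∂_b f)₂`. -/
theorem separatedPressure_of_clebschSlope (hrate : HasTypeITimeDecay C v)
    (hcont : ContinuousOn (uncurry v) (Iio (0 : ℝ) ×ˢ univ))
    (hmild : ∀ s t : ℝ, s < t → t < 0 → ∀ x,
      v t x = UnboundedOperators.heatExtension (v s) (t - s) x - oseenDuhamel 1 s v v t x)
    (hdiv : ∀ t < 0, VectorCalculus.IsDivFree (v t))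
    (hpol : ∀ s < 0, ∀ y, ⟪curl (v s) y, EuclideanSpace.single 2 1⟫_ℝ = 0) {μ : ℝ} (hμ : μ ≠ 1)
    (hslope : ∀ s < 0, ∀ y, ∀ b : Fin 3, b ≠ 2 →
      fderiv ℝ (v s) y (EuclideanSpace.single 2 1) b = μ * fderiv ℝ (v s) y (EuclideanSpace.single b 1) 2)
    {t : ℝ} (ht : t < 0) (x : EuclideanSpace ℝ (Fin 3)) {b : Fin 3} (hb : b ≠ 2) :
    fderiv ℝ (fun y => timeDerivWithin (Iio 0) v t y + convect (v t) (v t) y - Δ (v t) y) x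
          (EuclideanSpace.single b 1) 2 = 0 ∧
      fderiv ℝ (fun y => timeDerivWithin (Iio 0) v t y + convect (v t) (v t) y - Δ (v t) y) x
          (EuclideanSpace.single 2 1) b = 0 := by
  have hA : IsTypeIAncientMild C v := isTypeIAncientMild_of_class hrate hcont hmild hdiv
  have hs : ContDiff ℝ ∞ (v t) := hA.contDiff_slice ht
  have hb' : b = 0 ∨ b = 1 := by
    fin_cases b <;> simp at hb ⊢
  -- ## the two laws (`e₃`-derivative of `v_b`, `e_b`-derivative of `v₂`) and `curl f = 0`
  have hL3 := fderiv_equation_coord hrate hcont hmild hdiv ht x (EuclideanSpace.single 2 1) b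
  have hLb := fderiv_equation_coord hrate hcont hmild hdiv ht x (EuclideanSpace.single b 1) 2
  rw [apply_apply_coord] at hL3 hLb
  obtain ⟨hc0, hc1⟩ := fderiv_residual_symm hrate hcont hmild hdiv ht x
  -- ## `L(∂₂v_b) = μ L(∂_b v₂)`: the constrained scalar is a constant multiple of the other one
  have hfun_t : (fun s => fderiv ℝ (v s) x (EuclideanSpace.single 2 1) b) =ᶠ[𝓝 t]
      fun s => μ * fderiv ℝ (v s) x (EuclideanSpace.single b 1) 2 := by
    filter_upwards [Iio_mem_nhds ht] with s hs' using hslope s hs' x b hb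
  have hfun_x : (fun y => fderiv ℝ (v t) y (EuclideanSpace.single 2 1) b) =
      fun y => μ * fderiv ℝ (v t) y (EuclideanSpace.single b 1) 2 := funext fun y => hslope t ht y b hb
  have hg : ContDiff ℝ ∞ (fun y => fderiv ℝ (v t) y (EuclideanSpace.single b 1) 2) := by
    have h1 : ContDiff ℝ ∞ (fun y => fderiv ℝ (v t) y (EuclideanSpace.single b 1)) :=
      (hs.fderiv_right (m := ∞) (by norm_cast)).clm_apply contDiff_const
    exact (EuclideanSpace.proj (𝕜 := ℝ) (2 : Fin 3) : EuclideanSpace ℝ (Fin 3) →L[ℝ] ℝ).contDiff.comp h1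
  have hT : deriv (fun s => fderiv ℝ (v s) x (EuclideanSpace.single 2 1) b) t =
      μ * deriv (fun s => fderiv ℝ (v s) x (EuclideanSpace.single b 1) 2) t := by
    rw [hfun_t.deriv_eq, deriv_const_mul_field]
  have hX : fderiv ℝ (fun y => fderiv ℝ (v t) y (EuclideanSpace.single 2 1) b) x (v t x) =
      μ * fderiv ℝ (fun y => fderiv ℝ (v t) y (EuclideanSpace.single b 1) 2) x (v t x) := by
    rw [hfun_x, fderiv_const_mul ((hg.differentiable (by simp)) x), smul_apply, smul_eq_mul]
  have hΔ : Δ (fun y => fderiv ℝ (v t) y (EuclideanSpace.single 2 1) b) x =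
      μ * Δ (fun y => fderiv ℝ (v t) y (EuclideanSpace.single b 1) 2) x := by
    rw [hfun_x]
    have hfun : (fun y => μ * fderiv ℝ (v t) y (EuclideanSpace.single b 1) 2) =
        μ • fun y => fderiv ℝ (v t) y (EuclideanSpace.single b 1) 2 := by
      funext y; simp
    rw [hfun, InnerProductSpace.laplacian_smul μ (hg.contDiffAt.of_le (by norm_cast)), smul_eq_mul]
  -- ## subtract the two laws: `μ((∂_b f)₂ − (Dv ∂_b v)₂) = (∂₂f)_b − (Dv ∂₂v)_b`
  have hstar : μ * (fderiv ℝ (fun y => timeDerivWithin (Iio 0) v t y + convect (v t) (v t) y - Δ (v t) y) x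
        (EuclideanSpace.single b 1) 2 -
        ∑ j : Fin 3, fderiv ℝ (v t) x (EuclideanSpace.single b 1) j *
          fderiv ℝ (v t) x (EuclideanSpace.single j 1) 2) =
      fderiv ℝ (fun y => timeDerivWithin (Iio 0) v t y + convect (v t) (v t) y - Δ (v t) y) x
        (EuclideanSpace.single 2 1) b -
        ∑ j : Fin 3, fderiv ℝ (v t) x (EuclideanSpace.single 2 1) j *
          fderiv ℝ (v t) x (EuclideanSpace.single j 1) b := by
    rw [← hLb, ← hL3, hT, hX, hΔ]
    ring
  -- ## the pointwise inputs: constant slope at `(t,x)`, `∂₀v₁ = ∂₁v₀`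
  have h20 : fderiv ℝ (v t) x (EuclideanSpace.single 2 1) 0 = μ * fderiv ℝ (v t) x (EuclideanSpace.single 0 1) 2 :=
    hslope t ht x 0 (by decide)
  have h21 : fderiv ℝ (v t) x (EuclideanSpace.single 2 1) 1 = μ * fderiv ℝ (v t) x (EuclideanSpace.single 1 1) 2 :=
    hslope t ht x 1 (by decide)
  have hω2 : curl (v t) x 2 = 0 := by simpa [EuclideanSpace.inner_single_right] using hpol t ht x
  have hsym : fderiv ℝ (v t) x (EuclideanSpace.single 0 1) 1 = fderiv ℝ (v t) x (EuclideanSpace.single 1 1) 0 := by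
    have h : fderiv ℝ (v t) x (EuclideanSpace.single 0 1) 1 - fderiv ℝ (v t) x (EuclideanSpace.single 1 1) 0 = 0 := by
      simpa [curl] using hω2
    linarith
  have hμ' : μ - 1 ≠ 0 := sub_ne_zero.2 hμ
  -- name the nine gradient entries and the four residual derivatives
  obtain ⟨D, hD⟩ : ∃ D : EuclideanSpace ℝ (Fin 3) →L[ℝ] EuclideanSpace ℝ (Fin 3), fderiv ℝ (v t) x = D := ⟨_, rfl⟩
  obtain ⟨G, hG⟩ : ∃ G : EuclideanSpace ℝ (Fin 3) →L[ℝ] EuclideanSpace ℝ (Fin 3),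
      fderiv ℝ (fun y => timeDerivWithin (Iio 0) v t y + convect (v t) (v t) y - Δ (v t) y) x = G := ⟨_, rfl⟩
  rw [hD] at hstar h20 h21 hsym
  rw [hG] at hstar hc0 hc1 ⊢
  rcases hb' with rfl | rfl
  · simp only [Fin.sum_univ_three] at hstar
    have h1 : (μ - 1) * G (EuclideanSpace.single 0 1) 2 = 0 := by
      linear_combination hstar - hc0 - (D (EuclideanSpace.single 0 1) 0 + D (EuclideanSpace.single 2 1) 2) * h20
        - D (EuclideanSpace.single 1 1) 0 * h21 + μ * D (EuclideanSpace.single 1 1) 2 * hsym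
    have h2 : G (EuclideanSpace.single 0 1) 2 = 0 := (mul_eq_zero.1 h1).resolve_left hμ'
    exact ⟨h2, by rw [← hc0, h2]⟩
  · simp only [Fin.sum_univ_three] at hstar
    have h1 : (μ - 1) * G (EuclideanSpace.single 1 1) 2 = 0 := by
      linear_combination hstar - hc1 - D (EuclideanSpace.single 0 1) 1 * h20
        - (D (EuclideanSpace.single 1 1) 1 + D (EuclideanSpace.single 2 1) 2) * h21 - μ * D (EuclideanSpace.single 0 1) 2 * hsym
    have h2 : G (EuclideanSpace.single 1 1) 2 = 0 := (mul_eq_zero.1 h1).resolve_left hμ'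
    exact ⟨h2, by rw [← hc1, h2]⟩

end Summit.NavierStokesRegularity.NavierStokesRegularity.Theorems.PoloidalWindowDoorPoloidalWindowRigiditySeparatedPressure

end
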